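import Literature.Probability.LatticeModels.PolymerPressure
import Literature.Probability.LatticeModels.ThermodynamicLimit
import HarnessLib

/-!
# Half-open rectangles of `ℤ^d` and the tiling of the cube `[0,L)^d` by their translates

Topic `Literature/Probability/LatticeModels` (next to `halfOpenBox`, `shiftSet`). For side lengths
`m : Fin d → ℕ` the half-open rectangle `halfOpenRect m = ∏_i [0, m_i) ⊆ ℤ^d`, and the translation
vectors `rectTilingVecs m L = {(m_i q_i)_i : 0 ≤ q_i < ⌊L/m_i⌋}` whose translates of the rectangle are
pairwise DISJOINT and lie inside the cube `halfOpenBox d L = [0,L)^d`; there are `∏_i ⌊L/m_i⌋` of them, so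
they cover all but `L^d − ∏_i m_i⌊L/m_i⌋ = O(L^{d−1})` sites. This is the bookkeeping behind «box
subadditivity» bounds for translation-invariant states on tori (entropy rows of thermal certificates:
`S(ρ_L) ≤ N_L · S(ρ_B) + seam · log 4`, `N_L = ∏ ⌊L/m_i⌋`).

Everything is PROVED; two definitions with bodies (`halfOpenRect`, `rectTilingVecs`).
References: Friedli–Velenik 2017 §3.2 (boxes of `ℤ^d`), §6.9 (van Hove sequences / boundary bookkeeping).
-/

noncomputable section

namespace Literature.Probability.LatticeModels

open Finset

variable {d : ℕ}

/-- The half-open rectangle `∏_i [0, m_i) ⊆ ℤ^d` with integer side lengths `m_i`.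
[cite: FriedliVelenik2017, §3.2] -/
def halfOpenRect (m : Fin d → ℕ) : Finset (Site d) :=
  Fintype.piFinset fun i => Finset.Ico (0 : ℤ) (m i)

/-- Membership: every coordinate lies in `[0, m_i)`. [cite: FriedliVelenik2017, §3.2] -/
@[simp] theorem mem_halfOpenRect {m : Fin d → ℕ} {x : Site d} :
    x ∈ halfOpenRect m ↔ ∀ i, 0 ≤ x i ∧ x i < m i := by
  simp [halfOpenRect, Fintype.mem_piFinset]

/-- `|halfOpenRect m| = ∏_i m_i`. [cite: FriedliVelenik2017, §3.2] -/
theorem card_halfOpenRect (m : Fin d → ℕ) : #(halfOpenRect m) = ∏ i, m i := by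
  rw [halfOpenRect, Fintype.card_piFinset]
  simp

/-- A rectangle with sides `m_i ≤ ℓ` lies in the cube `[0, ℓ)^d`. [cite: FriedliVelenik2017, §3.2] -/
theorem halfOpenRect_subset_halfOpenBox {m : Fin d → ℕ} {ℓ : ℕ} (h : ∀ i, m i ≤ ℓ) :
    halfOpenRect m ⊆ halfOpenBox d ℓ := by
  intro x hx
  rw [mem_halfOpenRect] at hx
  rw [mem_halfOpenBox]
  intro i
  have := hx i
  have := h i
  constructor <;> omega

/-- **Tiling vectors**: the translations `v = (m_i q_i)_i`, `0 ≤ q_i < ⌊L/m_i⌋`, of the rectangle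
`halfOpenRect m` that fit into the cube `[0,L)^d`. [cite: FriedliVelenik2017, §3.2] -/
def rectTilingVecs (m : Fin d → ℕ) (L : ℕ) : Finset (Site d) :=
  (Fintype.piFinset fun i => Finset.Ico (0 : ℤ) ((L / m i : ℕ) : ℤ)).image fun q i => (m i : ℤ) * q i

/-- Membership in the tiling vectors. [cite: FriedliVelenik2017, §3.2] -/
theorem mem_rectTilingVecs {m : Fin d → ℕ} {L : ℕ} {v : Site d} :
    v ∈ rectTilingVecs m L ↔ ∃ q : Site d, (∀ i, 0 ≤ q i ∧ q i < ((L / m i : ℕ) : ℤ)) ∧ v = fun i => (m i : ℤ) * q i := by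
  simp only [rectTilingVecs, Finset.mem_image, Fintype.mem_piFinset, Finset.mem_Ico]
  constructor
  · rintro ⟨q, hq, rfl⟩
    exact ⟨q, hq, rfl⟩
  · rintro ⟨q, hq, rfl⟩
    exact ⟨q, hq, rfl⟩

/-- **There are `∏_i ⌊L/m_i⌋` tiling vectors** (positive side lengths). [cite: FriedliVelenik2017, §3.2] -/
theorem card_rectTilingVecs {m : Fin d → ℕ} (hm : ∀ i, 0 < m i) (L : ℕ) :
    #(rectTilingVecs m L) = ∏ i, (L / m i) := by
  rw [rectTilingVecs, Finset.card_image_of_injective, Fintype.card_piFinset]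
  · exact Finset.prod_congr rfl fun i _ => by rw [Int.card_Ico, sub_zero, Int.toNat_natCast]
  · intro q q' h
    funext i
    have hi := congrFun h i
    have hmi : (m i : ℤ) ≠ 0 := by exact_mod_cast (hm i).ne'
    exact mul_left_cancel₀ hmi hi

/-- **Translates fit into the cube**: for `v ∈ rectTilingVecs m L` and `B ⊆ halfOpenRect m`,
`B + v ⊆ [0, L)^d` (`m_i q_i + m_i ≤ m_i ⌊L/m_i⌋ ≤ L`). [cite: FriedliVelenik2017, §3.2] -/
theorem shiftSet_subset_halfOpenBox_of_mem_rectTilingVecs {m : Fin d → ℕ} {L : ℕ} {v : Site d}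
    (hv : v ∈ rectTilingVecs m L) {B : Finset (Site d)} (hB : B ⊆ halfOpenRect m) :
    shiftSet v B ⊆ halfOpenBox d L := by
  obtain ⟨q, hq, rfl⟩ := mem_rectTilingVecs.1 hv
  intro y hy
  rw [mem_shiftSet] at hy
  have hyB := mem_halfOpenRect.1 (hB hy)
  rw [mem_halfOpenBox]
  intro i
  have h1 := hyB i
  have h2 := hq i
  simp only [Pi.sub_apply] at h1
  have hmpos : (0 : ℤ) ≤ (m i : ℤ) := Int.natCast_nonneg _
  -- `m_i * ⌊L/m_i⌋ ≤ L`
  have hdiv : (m i : ℤ) * ((L / m i : ℕ) : ℤ) ≤ (L : ℤ) := by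
    exact_mod_cast Nat.mul_div_le L (m i)
  -- `m_i * q_i + m_i ≤ m_i * ⌊L/m_i⌋`
  have hq' : (m i : ℤ) * q i + (m i : ℤ) ≤ (m i : ℤ) * ((L / m i : ℕ) : ℤ) := by
    have : q i + 1 ≤ ((L / m i : ℕ) : ℤ) := by omega
    nlinarith
  have hq0 : 0 ≤ (m i : ℤ) * q i := mul_nonneg hmpos h2.1
  constructor <;> linarith

/-- **Distinct tiling vectors give disjoint translates** of any `B ⊆ halfOpenRect m` (in the coordinate
where the multipliers differ the translates occupy disjoint blocks `[m_i q_i, m_i(q_i+1))`).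
[cite: FriedliVelenik2017, §3.2] -/
theorem disjoint_shiftSet_of_mem_rectTilingVecs {m : Fin d → ℕ} {L : ℕ} {v w : Site d}
    (hv : v ∈ rectTilingVecs m L) (hw : w ∈ rectTilingVecs m L) (hne : v ≠ w)
    {B : Finset (Site d)} (hB : B ⊆ halfOpenRect m) : Disjoint (shiftSet v B) (shiftSet w B) := by
  obtain ⟨q, hq, rfl⟩ := mem_rectTilingVecs.1 hv
  obtain ⟨q', hq', rfl⟩ := mem_rectTilingVecs.1 hw
  have hqq : q ≠ q' := by
    intro h
    exact hne (by rw [h])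
  obtain ⟨i, hi⟩ : ∃ i, q i ≠ q' i := by
    by_contra h
    push Not at h
    exact hqq (funext h)
  rw [Finset.disjoint_left]
  intro y hy hy'
  rw [mem_shiftSet] at hy hy'
  have h1 := (mem_halfOpenRect.1 (hB hy)) i
  have h2 := (mem_halfOpenRect.1 (hB hy')) i
  simp only [Pi.sub_apply] at h1 h2
  -- `m_i q_i ≤ y_i < m_i (q_i + 1)` and the same for `q'`: forces `q_i = q'_i`
  have hm0 : (0 : ℤ) < (m i : ℤ) := by
    have : (0 : ℤ) ≤ y i - (m i : ℤ) * q i := h1.1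
    have : y i - (m i : ℤ) * q i < (m i : ℤ) := h1.2
    linarith
  rcases lt_or_gt_of_ne hi with hlt | hlt
  · have : q i + 1 ≤ q' i := by omega
    nlinarith [h1.1, h1.2, h2.1, h2.2]
  · have : q' i + 1 ≤ q i := by omega
    nlinarith [h1.1, h1.2, h2.1, h2.2]

/-- **Coverage**: the tiles cover `∏_i m_i ⌊L/m_i⌋` sites, i.e. all but `L^d − ∏_i m_i⌊L/m_i⌋` sites of the
cube; in particular `∏_i (L + 1 − m_i) ≤ #tiles · #B` for the full rectangle (`m_i⌊L/m_i⌋ ≥ L + 1 − m_i`).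
[cite: FriedliVelenik2017, §3.2] -/
theorem prod_sub_le_card_rectTilingVecs_mul {m : Fin d → ℕ} (hm : ∀ i, 0 < m i) (L : ℕ) :
    ∏ i, (L + 1 - m i) ≤ #(rectTilingVecs m L) * ∏ i, m i := by
  rw [card_rectTilingVecs hm, ← Finset.prod_mul_distrib]
  refine Finset.prod_le_prod' fun i _ => ?_
  have h := Nat.div_add_mod L (m i)
  have hmod := Nat.mod_lt L (hm i)
  -- `L + 1 - m ≤ (L / m) * m` since `L = m * (L/m) + L % m` with `L % m ≤ m - 1`
  have : L + 1 - m i ≤ m i * (L / m i) := by omega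
  simpa [mul_comm] using this

end Literature.Probability.LatticeModels

end
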